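import Mathlib
import Literature.Computability.Complexity.CliqueTestGraphs
import Summits.PneNP.PneNP.Theorems.ConvexRankGatesConvexGateBlindThresholds
import Summits.PneNP.PneNP.Theorems.ConvexRankGatesConvexGateBlindFewVariables
import Summits.PneNP.PneNP.Theorems.ConvexRankGatesConvexGateBlindMatchingCount

/-!
# PneNP / ConvexRankGates — `ConvexGateBlind`: LP separators need Ω(m/c) auxiliary variables

Helpers (`--supports stmt-PneNP-10680`): an UNCONDITIONAL corner of the crux `ConvexGateBlind` — its LP
(diagonal) slice with `o(m)` variables. Combining "one LP gate with `p` rows and `q` variables is an AND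
of `≤ (p+1)^{q+1} 2^q` valid non-negative thresholds" (`…FewVariables.lean`) with "one valid threshold
rejects at most a `(k-1)^{-m/2+O(k²)}` fraction of the colourings" (`…MatchingCount.lean`):
* `linearVariables_numerics`, `eventually_linearVariables_condition` — exponent bookkeeping for
  `k = ⌈m^{1/4}⌉₊` and the variable budget `64 (c+2) (q+1) ≤ m`;
* `convexGateBlind_lpLinearVariables_corner` — in the shape of the crux: for `δ = 1/4`, every `c` and all
  large `m`, no one-gate circuit over `{∧₂, ∨₂} ∪ LP` whose gate has `p + q ≤ m^c` and
  `64 (c+2)(q+1) ≤ m` computes `CLIQUE(m, ⌈m^δ⌉₊)`. So a monotone LP separator of `⌈m^{1/4}⌉`-cliques from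
  `⌈m^{1/4}⌉`-clique-free graphs with `m^c` constraints needs more than `m/(64(c+2)) - 1` auxiliary
  variables — one per `O(c)` vertices; the `q = 0` case is `convexGateBlind_thresholdAnd_corner`.
The counting is exponential in the number of LP VARIABLES only, which is why it stops at `q = Θ(m/c)`;
the full LP half of the crux (`q ≤ m^c`) is Hrubeš's open problem on monotone separation complexity
(Hrubeš 2020, Open Problem 3), and the SDP half is further out. [folklore; the count is this route's]
-/

namespace Summit.PneNP.PneNP.Theorems

open Matrix Finset Filter Topology

/-! ### Exponent bookkeeping for `k = ⌈m^{1/4}⌉₊` and `64 (c+2) (q+1) ≤ m` -/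

section linearVariables

open Literature.Computability.Complexity

/-- Pure arithmetic. If `k ≥ 3`, `m ≤ (k-1)^8`, `k² ≤ m`, `64 (c+2)(q+1) ≤ m` and
`m/8 + 8 + 9k² + (m+k)/2 + 1 ≤ m`, then one LP gate with `p + q ≤ m^c` and `q` variables is beaten by the
matching count: `(m^c+1)^{q+1} 2^q · k² m^{k²} (k-1)^{(m+k)/2 + k²} < (k-1)^m` (the left side is at most
`(k-1)^{8((c+2)(q+1) + 1 + k²) + (m+k)/2 + k²}` and the exponent is `< m`). [folklore] -/
theorem linearVariables_numerics {m k c q : ℕ} (hk : 3 ≤ k) (h8 : m ≤ (k - 1) ^ 8) (hk2 : k ^ 2 ≤ m)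
    (hq : 64 * (c + 2) * (q + 1) ≤ m) (hH : m / 8 + 8 + 9 * k ^ 2 + (m + k) / 2 + 1 ≤ m) (hm : 2 ≤ m) :
    (m ^ c + 1) ^ (q + 1) * 2 ^ q * (k ^ 2 * m ^ (k ^ 2) * (k - 1) ^ ((m + k) / 2 + k ^ 2)) <
      (k - 1) ^ m := by
  set X := (c + 2) * (q + 1) with hXdef
  have hX : 64 * X ≤ m := by rw [hXdef, ← mul_assoc]; exact hq
  have h1 : m ^ c + 1 ≤ m ^ (c + 1) := by
    rw [pow_succ]
    have : m ^ c * 2 ≤ m ^ c * m := Nat.mul_le_mul_left _ hm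
    have hpos : 1 ≤ m ^ c := Nat.one_le_pow _ _ (by omega)
    omega
  have h2 : (m ^ c + 1) ^ (q + 1) * 2 ^ q ≤ m ^ X := by
    calc (m ^ c + 1) ^ (q + 1) * 2 ^ q ≤ (m ^ (c + 1)) ^ (q + 1) * m ^ (q + 1) :=
          Nat.mul_le_mul (Nat.pow_le_pow_left h1 _)
            ((Nat.pow_le_pow_left hm _).trans (Nat.pow_le_pow_right (by omega) (Nat.le_succ q)))
      _ = m ^ X := by rw [hXdef, ← pow_mul, ← pow_add]; ring_nf
  have h3 : k ^ 2 * m ^ (k ^ 2) ≤ m ^ (1 + k ^ 2) := by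
    rw [pow_add, pow_one]
    exact Nat.mul_le_mul_right _ hk2
  have h4 : m ^ X * m ^ (1 + k ^ 2) ≤ (k - 1) ^ (8 * (X + 1 + k ^ 2)) := by
    rw [← pow_add, pow_mul]
    have : X + (1 + k ^ 2) = X + 1 + k ^ 2 := by ring
    rw [this]
    exact Nat.pow_le_pow_left h8 _
  have hq8 : 8 * X ≤ m / 8 := by
    rw [Nat.le_div_iff_mul_le (by norm_num)]
    omega
  have hlt : 8 * (X + 1 + k ^ 2) + ((m + k) / 2 + k ^ 2) < m := by omega
  have hk1 : 2 ≤ k - 1 := by omega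
  calc (m ^ c + 1) ^ (q + 1) * 2 ^ q * (k ^ 2 * m ^ (k ^ 2) * (k - 1) ^ ((m + k) / 2 + k ^ 2))
      = ((m ^ c + 1) ^ (q + 1) * 2 ^ q) * (k ^ 2 * m ^ (k ^ 2)) * (k - 1) ^ ((m + k) / 2 + k ^ 2) := by
        ring
    _ ≤ m ^ X * m ^ (1 + k ^ 2) * (k - 1) ^ ((m + k) / 2 + k ^ 2) :=
        Nat.mul_le_mul_right _ (Nat.mul_le_mul h2 h3)
    _ ≤ (k - 1) ^ (8 * (X + 1 + k ^ 2)) * (k - 1) ^ ((m + k) / 2 + k ^ 2) :=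
        Nat.mul_le_mul_right _ h4
    _ = (k - 1) ^ (8 * (X + 1 + k ^ 2) + ((m + k) / 2 + k ^ 2)) := by rw [← pow_add]
    _ < (k - 1) ^ m := Nat.pow_lt_pow_right (by omega) hlt

/-- The side condition `m/8 + 8 + 9k² + (m+k)/2 + 1 ≤ m` holds for `k = ⌈m^{1/4}⌉₊` and all large `m`
(namely `m ≥ 16⁴`: with `x = m^{1/4} ≥ 16`, `k ≤ 2x`, and `36 x² + x + 10 ≤ 3x⁴/8`). [folklore] -/
theorem eventually_linearVariables_condition : ∀ᶠ m : ℕ in atTop,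
    m / 8 + 8 + 9 * ⌈(m : ℝ) ^ (1 / 4 : ℝ)⌉₊ ^ 2 + (m + ⌈(m : ℝ) ^ (1 / 4 : ℝ)⌉₊) / 2 + 1 ≤ m := by
  filter_upwards [eventually_ge_atTop (16 ^ 4)] with m hm
  set x : ℝ := (m : ℝ) ^ (1 / 4 : ℝ) with hx
  set k : ℕ := ⌈x⌉₊ with hk
  have hx0 : 0 ≤ x := Real.rpow_nonneg (Nat.cast_nonneg m) _
  have hx4 : x ^ 4 = m := by
    rw [hx, ← Real.rpow_natCast, ← Real.rpow_mul (Nat.cast_nonneg m)]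
    norm_num
  have hA : (16 : ℝ) ≤ x := by
    by_contra hcon
    push Not at hcon
    have h1 : x ^ 4 < (16 : ℝ) ^ 4 := by gcongr
    have h2 : ((16 ^ 4 : ℕ) : ℝ) ≤ (m : ℝ) := by exact_mod_cast hm
    push_cast at h2
    linarith
  have hxk : x ≤ k := Nat.le_ceil x
  have hkx : (k : ℝ) < x + 1 := Nat.ceil_lt_add_one hx0
  have hk2x : (k : ℝ) ≤ 2 * x := by linarith
  have hk0 : (0 : ℝ) ≤ k := Nat.cast_nonneg k
  have hdiv8 : ((m / 8 : ℕ) : ℝ) ≤ (m : ℝ) / 8 := Nat.cast_div_le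
  have hdiv2 : (((m + k) / 2 : ℕ) : ℝ) ≤ ((m + k : ℕ) : ℝ) / 2 := Nat.cast_div_le
  have hmain : (m : ℝ) / 8 + 8 + 9 * (k : ℝ) ^ 2 + ((m : ℝ) + k) / 2 + 1 ≤ m := by
    have h1 : 9 * (k : ℝ) ^ 2 ≤ 36 * x ^ 2 := by nlinarith
    have hx2 : 256 ≤ x ^ 2 := by nlinarith
    have h2a : 36 * x ^ 2 + x + 10 ≤ 38 * x ^ 2 := by nlinarith
    have h2b : 38 * x ^ 2 ≤ 3 * x ^ 4 / 8 := by
      have h' : x ^ 4 = x ^ 2 * x ^ 2 := by ring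
      rw [h']
      nlinarith
    have h2 : 36 * x ^ 2 + x + 10 ≤ 3 * x ^ 4 / 8 := h2a.trans h2b
    rw [← hx4]
    nlinarith
  have hcast : (((m / 8 + 8 + 9 * k ^ 2 + (m + k) / 2 + 1 : ℕ)) : ℝ) ≤ m := by
    push_cast
    push_cast at hdiv2
    linarith
  exact_mod_cast hcast

/-! ### The linear-variables LP corner in the shape of the crux -/

open scoped Classical in
/-- **`ConvexGateBlind`, LP slice with `o(m)` variables, one gate** (unconditional). There is
`δ ∈ (0, 1/2)` (namely `δ = 1/4`) such that for every `c`, for all large `m`, no circuit with at most one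
gate over `{∧₂, ∨₂} ∪ LP` — monotone LP-feasibility gates `v ↦ [∃ z ≥ 0, A z ≤ b + B v]`, `B ≥ 0`, with
`p + q ≤ m^c` rows-plus-variables and `64 (c+2) (q+1) ≤ m`, i.e. fewer than `m / (64 (c+2))` auxiliary
variables (a diagonal slice of the route's `CONV_{m^c}`, `lpFew_subset_conv`) — computes
`CLIQUE(m, ⌈m^δ⌉₊)`, written inline as in the route file. In words: a monotone LP separator for
`CLIQUE(m, ⌈m^{1/4}⌉)` with polynomially many constraints needs `Ω(m / c)` auxiliary variables — one
per `O(c)` vertices (vertex-variable formulations have `q = m`). Proof: Farkas + Krein–Milman turn the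
gate into an AND of `≤ (p+1)^{q+1} 2^q` valid non-negative thresholds (`…Vertices.lean`), and the
matching count `card_colorings_sum_lt_le_half` lets each reject only a `(k-1)^{-m/2+O(k²)}` fraction of
the colourings (`…MatchingCount.lean`). The crux allows `m^c` variables, `m^c` gates and SDP blocks; its
full LP half is Hrubeš's open problem on monotone separation complexity. [folklore; the count is this route's] -/
theorem convexGateBlind_lpLinearVariables_corner :
    ∃ δ : ℝ, 0 < δ ∧ δ < 1 / 2 ∧ ∀ c : ℕ, ∀ᶠ m : ℕ in atTop,
      ∀ C : Circuit ((⊤ : SimpleGraph (Fin m)).edgeSet),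
        C.IsOver ({GateFn.and 2, GateFn.or 2} ∪ {g : GateFn | ∃ p q : ℕ, p + q ≤ m ^ c ∧
          64 * (c + 2) * (q + 1) ≤ m ∧
          ∃ (A : Fin p → Fin q → ℝ) (b : Fin p → ℝ) (B : Fin p → Fin g.1 → ℝ), (∀ i j, 0 ≤ B i j) ∧
            ∀ v : Fin g.1 → Bool, g.2 v = true ↔ ∃ z : Fin q → ℝ, (∀ j, 0 ≤ z j) ∧
              ∀ i, ∑ j, A i j * z j ≤ b i + ∑ j, B i j * (if v j then (1 : ℝ) else 0)}) →
        C.size ≤ 1 →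
        ¬ C.Computes (fun x => decide (¬ (SimpleGraph.fromEdgeSet {e : Sym2 (Fin m) |
          ∃ h : e ∈ (⊤ : SimpleGraph (Fin m)).edgeSet, x ⟨e, h⟩ = true}).CliqueFree
            ⌈(m : ℝ) ^ δ⌉₊)) := by
  refine ⟨1 / 4, by norm_num, by norm_num, fun c => ?_⟩
  filter_upwards [eventually_threshold_corner_conditions 0, eventually_linearVariables_condition,
    eventually_ge_atTop (64 * (c + 2))] with m hm hH h64 C hC hsize
  obtain ⟨h3, h8, hk2, -, hm2⟩ := hm
  set k : ℕ := ⌈(m : ℝ) ^ (1 / 4 : ℝ)⌉₊ with hk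
  have hs : 1 ≤ m ^ c := Nat.one_le_pow _ _ (by omega)
  have hkm : k ≤ m := le_trans (by nlinarith) hk2
  -- the variable budget `t = m / (64 (c+2)) - 1`
  set t : ℕ := m / (64 * (c + 2)) - 1 with ht
  have hpos : 0 < 64 * (c + 2) := by omega
  have ht1 : t + 1 = m / (64 * (c + 2)) := by
    have : 1 ≤ m / (64 * (c + 2)) := (Nat.le_div_iff_mul_le hpos).2 (by simpa using h64)
    omega
  have hq : 64 * (c + 2) * (t + 1) ≤ m := by
    rw [ht1]
    exact Nat.mul_div_le m (64 * (c + 2))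
  have hN := fun (w : (⊤ : SimpleGraph (Fin m)).edgeSet → ℝ) (hw : ∀ e, 0 ≤ w e) (θ : ℝ)
    (hθ : 0 < θ) (hQ : ∀ Q : Finset (Fin m), Q.card = k →
      θ ≤ ∑ e, if cliqueVec Q e = true then w e else 0) =>
    card_colorings_sum_lt_le_half (by omega) hkm w hw hθ hQ
  have hnum := linearVariables_numerics (c := c) (q := t) h3 h8 hk2 hq hH hm2
  refine not_computes_cliqueFn_of_lpFew (s := m ^ c) (t := t) h3 hs hN hnum C (fun g hg => ?_) hsize
  rcases hC g hg with h | ⟨p, q, hpq, hq', A, b, B, hB, hiff⟩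
  · exact Or.inl h
  · refine Or.inr ⟨p, q, hpq, ?_, A, b, B, hB, hiff⟩
    have : q + 1 ≤ m / (64 * (c + 2)) := (Nat.le_div_iff_mul_le hpos).2 (by
      calc (q + 1) * (64 * (c + 2)) = 64 * (c + 2) * (q + 1) := by ring
        _ ≤ m := hq')
    omega

end linearVariables

end Summit.PneNP.PneNP.Theorems
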